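import Summits.Ventures.CertifiedManyBodySolver.Downfold.EmeryBandEnclosure
import Summits.Ventures.CertifiedManyBodySolver.Downfold.OneBandBox
import Summits.Ventures.CertifiedManyBodySolver.Downfold.ParameterBoxJoin
import HarnessLib

/-!
# The typed three-band → one-band statement: `threeToOneBand : EmeryBox → OneBandBox`, its
# SOUNDNESS TOKEN, and word transport (INFL-3to1 as hulled determinations with declared misfit)

Venture CertifiedManyBodySolver, cell `pub/hubbard-downfold` (HUMAN RULINGS D-0096/D-0098: stage S1 =
DOWNFOLDING FRONT END = ROUTER; «the three-band → one-band reduction error is carried as box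
inflation, never hidden»), seat hubbard-downfold-mod-4 (writer; reviewer hubbard-downfold-unc-3, §A =
mod-3); namespace `Summit.Ventures.CertifiedManyBodySolver.Downfold`. Everything here is PROVED.
WHAT THIS IS NOT: a certified statement about any material; not a claim that a cuprate IS a
one-band Hubbard model (that is the ASSUMPTION TOKEN below, printed with every box and never
discharged inside Lean); no literature number lives here (the La₂CuO₄ worked example is
SCREENING-GRADE and lives in `router/BOXES/La2CuO4-family.md §REDUCTION-B`).

* `EmeryCoord` — the 3BE coordinate tokens of `router/BOX-SCHEMA.md` §1 (`Delta_pd, t_pd, t_pp,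
  t_pp', U_dd, U_pp, V_pd, n_holes`); `EmeryBox := Box EmeryCoord` (mod-1's `Downfold.Box`: per
  coordinate a graded rational `Entry` or `none` = undetermined).
* §1 (in `Downfold.EmeryBandEnclosure`) the RATIONAL interval images `tI`, `tpIk`, `tppI` of a
  three-band box `D × A × B × C ∋ (Δ, t_pd, t_pp, t_pp′)` (`t_pp′` = across-Cu O–O hopping, an
  exact shift of `Δ` at X/M/S: `EmeryBandReductionAcrossCu`): `t` by the CORNER rule, `t′` by the
  Δ′-SUBDIVIDED enclosure with exact `t_pd`, `t_pp` corners (reviewer R4: mixed corners + optional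
  splitting), `t″` by mixed corners; certified `√` from the tree's `sqrtDown/sqrtUp`.
* (in `Downfold.ParameterBoxJoin`) `Box.join` — coordinatewise hull of determination boxes in which
  an ABSENT entry abstains: the BOX-WIDTH ALGEBRA of ROUTER v0.5 §4.3 / BOX-SCHEMA R2 («every
  admissible determination — direct fit, technique A, technique B — is hulled in; INFL-3to1 mode =
  hulled»), `Box.mem_join` (per-coordinate disjunctive trust), `Box.refines_join_left` (R6).
* §1 `BConfig` (precision of `√`, declared misfit radii `rT, rTp, rTpp : ℚ≥0` in eV — by
  `EmeryBlochBand.abs_extract*_sub_le` a band misfit `ρ` at Γ, X, M, S licenses `ρ/4` each —, an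
  optional one-band `U` determination in eV, the grade of the reduction claim) and
  `imageB cfg E : OneBandBox` — technique B's DETERMINATION of the 1BH coordinates in S2's frame
  (reviewer R1/R7): `t_eV = tI ⊕ rT`, `tp/t = (tpI ⊕ rTp)/(tI ⊕ rT)`, `tpp/t` likewise (`divPos`;
  undetermined if the scale interval touches `0`), `U/t = U/(tI ⊕ rT)` if a `U` is supplied,
  `n = 2 − n_holes`; grades combine by `Grade.weakest`.
* §2 `ReductionTokenB cfg E p` — the ASSUMPTION TOKEN (reviewer R2): «the material's effective
  one-band parameters `p` come from hoppings `(t, t′, t″)` within the declared misfits of the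
  technique-B image of SOME point of the three-band box, `t > 0`, with `U = t·(U/t)` enclosed by the
  supplied `U` determination and `n = 2 − n_holes`». SOUNDNESS `imageB_mem_of_token`: the token puts
  `p` in `imageB cfg E`. `threeToOneBand cfg E direct := direct.join (imageB cfg E)` and
  `threeToOneBand_mem_of_token` / `threeToOneBand_word`: under the token (plus direct enclosure on
  the coordinates technique B does not determine) every word S2 certifies on the delivered box
  (`HoldsOn`, `OneBandBox.holdsOn_oneBand_of_cell`, `S2Seam`) holds at `p`.

Technique A (cell perturbation, mod-3) enters the same way: a further `OneBandBox` determination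
joined in (`Box.join` is associative in effect; each source carries its own token).
-/

namespace Summit.Ventures.CertifiedManyBodySolver.Downfold

open NonemptyInterval Literature.Analysis.ValidatedNumerics
open Summit.Ventures.CertifiedManyBodySolver.Downfold.Emery

/-- **Coordinates of a three-band (Emery) box** (BOX-SCHEMA v0.1 §1 tokens for the `3BE` block):
`Delta_pd` (charge-transfer energy `ε_p − ε_d`, hole language, eV), `t_pd`, `t_pp`, `t_pp'`,
`U_dd`, `U_pp`, `V_pd` (eV), `n_holes` (holes per CuO₂ unit, `1 + x`). [folklore] -/
inductive EmeryCoord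
  | DeltaPd
  | tpd
  | tpp
  | tppP
  | Udd
  | Upp
  | Vpd
  | nHoles
  deriving DecidableEq, Repr

/-- A three-band (Emery) parameter box (`3BE` block). [folklore] -/
abbrev EmeryBox : Type := Box EmeryCoord

/-! ## §1 Technique B's determination of the one-band box -/

/-- **Configuration of the technique-B reduction**: precision of the certified square root
(`prec` dyadic digits, `iters` Heron steps), the `Δ′`-subdivision count for `t′`, whether the
hopping RATIOS are emitted at all, the DECLARED MISFIT radii in eV on `t`, `t′`, `t″`
(the one-band-form residual of the antibonding band converted per coordinate —
`EmeryBlochBand.abs_extract*_sub_le`: a band misfit `ρ` at Γ, X, M, S licenses `ρ/4` each), an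
optional admissible one-band `U` determination in eV, and the grade of the reduction claim
(`screening` for any DFT/literature input). [folklore] -/
structure BConfig where
  /-- dyadic precision of `sqrtDown/sqrtUp` -/
  prec : ℕ
  /-- Heron iterations of `sqrtDown/sqrtUp` -/
  iters : ℕ
  /-- number of extra `Δ′`-pieces for the `t′` enclosure (`nsplit + 1` pieces) -/
  nsplit : ℕ
  /-- emit the hopping-ratio coordinates `tp/t`, `tpp/t`? (cell ROUTER v0.6.1: three-band-internal
  `t′` values are CONTEXT, not box end points — then `false` and technique B abstains on them) -/
  ratios : Bool
  /-- declared misfit radius on `t` [eV] -/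
  rT : ℚ≥0
  /-- declared misfit radius on `t′` [eV] -/
  rTp : ℚ≥0
  /-- declared misfit radius on `t″` [eV] -/
  rTpp : ℚ≥0
  /-- an admissible one-band `U` determination [eV], if any (else `U/t` is not determined here) -/
  uEV : Option Entry
  /-- grade of the reduction claim itself -/
  grade : Grade

/-- The four one-body input entries technique B reads (`Delta_pd`, `t_pd`, `t_pp`, `t_pp'`), if
all present (a model without across-Cu hopping carries the explicit entry `t_pp' = [0, 0]`).
[folklore] -/
def inputsB (E : EmeryBox) : Option (Entry × Entry × Entry × Entry) :=
  match E .DeltaPd, E .tpd, E .tpp, E .tppP with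
  | some eD, some eA, some eB, some eC => some (eD, eA, eB, eC)
  | _, _, _, _ => none

/-- The inflated scale interval `T = tI ⊕ rT` of technique B. [folklore] -/
def scaleB (cfg : BConfig) (eD eA eB eC : Entry) : NonemptyInterval ℚ :=
  (tI cfg.prec cfg.iters eD.encl eA.encl eB.encl eC.encl).inflate cfg.rT

/-- The inflated `t′` interval `TP = tpI ⊕ rTp` of technique B. [folklore] -/
def tpIB (cfg : BConfig) (eD eA eB eC : Entry) : NonemptyInterval ℚ :=
  (tpIk cfg.prec cfg.iters cfg.nsplit eD.encl eA.encl eB.encl eC.encl).inflate cfg.rTp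

/-- The inflated `t″` interval `TPP = tppI ⊕ rTpp` of technique B. [folklore] -/
def tppIB (cfg : BConfig) (eD eA eB eC : Entry) : NonemptyInterval ℚ :=
  (tppI cfg.prec cfg.iters eD.encl eA.encl eB.encl eC.encl).inflate cfg.rTpp

/-- The combined grade of a technique-B entry: weakest of the four inputs and the reduction.
[folklore] -/
def gradeB (cfg : BConfig) (eD eA eB eC : Entry) : Grade :=
  (((eD.grade.weakest eA.grade).weakest eB.grade).weakest eC.grade).weakest cfg.grade

/-- **Technique B's determination of the one-band box** in S2's frame: `t_eV = tI ⊕ rT`;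
`tp/t = (tpIk ⊕ rTp)/(tI ⊕ rT)` and `tpp/t` by the positive-quotient rule `divPos` when
`cfg.ratios` is set and the scale interval is positive (else undetermined); `U/t = U/(tI ⊕ rT)` if
a `U` determination is supplied;
`n = 2 − n_holes` from the three-band filling entry; every other coordinate undetermined. If any
of `Delta_pd, t_pd, t_pp, t_pp'` is undetermined, so is every hopping-derived coordinate.
[folklore] -/
def imageB (cfg : BConfig) (E : EmeryBox) : OneBandBox := fun c =>
  match c with
  | .filling =>
    match E .nHoles with
    | some eN => some ⟨eN.encl.affine 2 (-1), 0, eN.grade⟩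
    | none => none
  | .tEV =>
    match inputsB E with
    | some (eD, eA, eB, eC) => some ⟨tI cfg.prec cfg.iters eD.encl eA.encl eB.encl eC.encl,
        cfg.rT, gradeB cfg eD eA eB eC⟩
    | none => none
  | .tpOverT =>
    match inputsB E with
    | some (eD, eA, eB, eC) =>
      if h : cfg.ratios = true ∧ 0 < (scaleB cfg eD eA eB eC).fst then
        some ⟨(tpIB cfg eD eA eB eC).divPos (scaleB cfg eD eA eB eC) h.2, 0, gradeB cfg eD eA eB eC⟩
      else none
    | none => none
  | .tppOverT =>
    match inputsB E with
    | some (eD, eA, eB, eC) =>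
      if h : cfg.ratios = true ∧ 0 < (scaleB cfg eD eA eB eC).fst then
        some ⟨(tppIB cfg eD eA eB eC).divPos (scaleB cfg eD eA eB eC) h.2, 0, gradeB cfg eD eA eB eC⟩
      else none
    | none => none
  | .UOverT =>
    match inputsB E, cfg.uEV with
    | some (eD, eA, eB, eC), some eU =>
      if h : 0 < (scaleB cfg eD eA eB eC).fst then
        some ⟨eU.encl.divPos (scaleB cfg eD eA eB eC) h, 0,
          (gradeB cfg eD eA eB eC).weakest eU.grade⟩
      else none
    | _, _ => none
  | _ => none

/-! ## §2 The soundness token, soundness, the joined box, word transport -/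

/-- **ASSUMPTION TOKEN of the technique-B reduction** (the physics; carried with the box, never
discharged in Lean): the material's effective one-band parameter vector `p` (S2 frame) arises from
one-band hoppings `(t, t′, t″)` in eV that lie within the declared misfits `rT, rTp, rTpp` of the
technique-B image of SOME point `(Δ, t_pd, t_pp, t_pp′)` enclosed by the three-band box, with
`t > 0`,
`p t_eV = t`, `p tp/t = t′/t`, `p tpp/t = t″/t`; the supplied `U` determination (if any) encloses
the one-band `U = t · (U/t)`; and the three-band filling entry (if any) encloses `2 − n`
(three clauses: hoppings `.1`, interaction `.2.1`, filling `.2.2`). A predicate on `p`, i.e. a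
HYPOTHESIS of every downstream statement — S1 asserts nothing unconditionally. [folklore] -/
def ReductionTokenB (cfg : BConfig) (E : EmeryBox) (p : OneBandCoord → ℝ) : Prop :=
  (∃ Δ a b c t tp tpp : ℝ,
    (∀ e, E .DeltaPd = some e → e.Mem Δ) ∧ (∀ e, E .tpd = some e → e.Mem a) ∧
    (∀ e, E .tpp = some e → e.Mem b) ∧ (∀ e, E .tppP = some e → e.Mem c) ∧
    |t - tB4 Δ a b c| ≤ (cfg.rT : ℚ) ∧ |tp - tpB4 Δ a b c| ≤ (cfg.rTp : ℚ) ∧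
    |tpp - tppB4 Δ a b c| ≤ (cfg.rTpp : ℚ) ∧
    0 < t ∧ p .tEV = t ∧ p .tpOverT = tp / t ∧ p .tppOverT = tpp / t) ∧
  (∀ eU, cfg.uEV = some eU → eU.Mem (p .tEV * p .UOverT)) ∧
  (∀ eN, E .nHoles = some eN → eN.Mem (2 - p .filling))

/-- Under the token, the scale, `t′` and `t″` intervals of technique B enclose `t`, `t′`, `t″`.
[folklore] -/
theorem hop_mem_of_token {cfg : BConfig} {E : EmeryBox} {p : OneBandCoord → ℝ}
    (tok : ReductionTokenB cfg E p) {eD eA eB eC : Entry} (hD : E .DeltaPd = some eD)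
    (hA : E .tpd = some eA) (hB : E .tpp = some eB) (hC : E .tppP = some eC)
    (hA0 : 0 < eA.encl.fst) :
    ∃ t tp tpp : ℝ, 0 < t ∧ p .tEV = t ∧ p .tpOverT = tp / t ∧ p .tppOverT = tpp / t ∧
      t ∈ (scaleB cfg eD eA eB eC).ratCast ℝ ∧ tp ∈ (tpIB cfg eD eA eB eC).ratCast ℝ ∧
      tpp ∈ (tppIB cfg eD eA eB eC).ratCast ℝ := by
  obtain ⟨Δ, a, b, c, t, tp, tpp, hΔ, ha, hb, hc, ht, htp, htpp, ht0, hpt, hptp, hptpp⟩ := tok.1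
  refine ⟨t, tp, tpp, ht0, hpt, hptp, hptpp, ?_, ?_, ?_⟩
  · exact mem_inflate_of_abs_sub_le
      (tB4_mem_tI cfg.prec cfg.iters hA0.le (hΔ eD hD) (ha eA hA) (hb eB hB) (hc eC hC)) ht
  · exact mem_inflate_of_abs_sub_le
      (tpB4_mem_tpIk cfg.prec cfg.iters cfg.nsplit hA0 (hΔ eD hD) (ha eA hA) (hb eB hB)
        (hc eC hC)) htp
  · exact mem_inflate_of_abs_sub_le
      (tppB4_mem_tppI cfg.prec cfg.iters hA0.le (hΔ eD hD) (ha eA hA) (hb eB hB) (hc eC hC)) htpp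

/-- **SOUNDNESS of technique B's determination**: if the three-band `t_pd` entry is positive
(sign convention) and the token holds for `p`, then `p` lies in `imageB cfg E`. [folklore] -/
theorem imageB_mem_of_token {cfg : BConfig} {E : EmeryBox} {p : OneBandCoord → ℝ}
    (hA0 : ∀ eA, E .tpd = some eA → 0 < eA.encl.fst) (tok : ReductionTokenB cfg E p) :
    (imageB cfg E).Mem p := by
  intro c g hg
  -- the four hopping inputs, when present
  have key : ∀ eD eA eB eC, inputsB E = some (eD, eA, eB, eC) →
      E .DeltaPd = some eD ∧ E .tpd = some eA ∧ E .tpp = some eB ∧ E .tppP = some eC := by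
    intro eD eA eB eC h
    unfold inputsB at h
    cases h1 : E .DeltaPd with
    | none => simp [h1] at h
    | some x =>
      cases h2 : E .tpd with
      | none => simp [h1, h2] at h
      | some y =>
        cases h3 : E .tpp with
        | none => simp [h1, h2, h3] at h
        | some z =>
          cases h4 : E .tppP with
          | none => simp [h1, h2, h3, h4] at h
          | some w =>
            simp only [h1, h2, h3, h4, Option.some.injEq, Prod.mk.injEq] at h
            obtain ⟨rfl, rfl, rfl, rfl⟩ := h
            exact ⟨rfl, rfl, rfl, rfl⟩
  cases c with
  | filling =>
    simp only [imageB] at hg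
    cases hN : E .nHoles with
    | none => simp [hN] at hg
    | some eN =>
      simp only [hN, Option.some.injEq] at hg
      subst hg
      have hm := tok.2.2 eN hN
      unfold Entry.Mem at hm ⊢
      simp only [Entry.encl, inflate_zero]
      have := mem_affine (K := ℝ) 2 (-1) hm
      have e : ((2 : ℚ) : ℝ) + ((-1 : ℚ) : ℝ) * (2 - p .filling) = p .filling := by push_cast; ring
      rw [e] at this
      exact this
  | tEV =>
    simp only [imageB] at hg
    cases hin : inputsB E with
    | none => simp [hin] at hg
    | some triple =>
      obtain ⟨eD, eA, eB, eC⟩ := triple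
      obtain ⟨hD, hA, hB, hC⟩ := key eD eA eB eC hin
      simp only [hin, Option.some.injEq] at hg
      subst hg
      obtain ⟨t, tp, tpp, ht0, hpt, -, -, htm, -, -⟩ :=
        hop_mem_of_token tok hD hA hB hC (hA0 eA hA)
      unfold Entry.Mem Entry.encl
      rw [hpt]
      exact htm
  | tpOverT =>
    simp only [imageB] at hg
    cases hin : inputsB E with
    | none => simp [hin] at hg
    | some triple =>
      obtain ⟨eD, eA, eB, eC⟩ := triple
      obtain ⟨hD, hA, hB, hC⟩ := key eD eA eB eC hin
      simp only [hin] at hg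
      split_ifs at hg with hpos
      simp only [Option.some.injEq] at hg
      subst hg
      obtain ⟨t, tp, tpp, ht0, hpt, hptp, -, htm, htpm, -⟩ :=
        hop_mem_of_token tok hD hA hB hC (hA0 eA hA)
      unfold Entry.Mem
      simp only [Entry.encl, inflate_zero]
      rw [hptp]
      exact div_mem_divPos hpos.2 htpm htm
  | tppOverT =>
    simp only [imageB] at hg
    cases hin : inputsB E with
    | none => simp [hin] at hg
    | some triple =>
      obtain ⟨eD, eA, eB, eC⟩ := triple
      obtain ⟨hD, hA, hB, hC⟩ := key eD eA eB eC hin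
      simp only [hin] at hg
      split_ifs at hg with hpos
      simp only [Option.some.injEq] at hg
      subst hg
      obtain ⟨t, tp, tpp, ht0, hpt, -, hptpp, htm, -, htppm⟩ :=
        hop_mem_of_token tok hD hA hB hC (hA0 eA hA)
      unfold Entry.Mem
      simp only [Entry.encl, inflate_zero]
      rw [hptpp]
      exact div_mem_divPos hpos.2 htppm htm
  | UOverT =>
    simp only [imageB] at hg
    cases hin : inputsB E with
    | none => simp [hin] at hg
    | some triple =>
      obtain ⟨eD, eA, eB, eC⟩ := triple
      obtain ⟨hD, hA, hB, hC⟩ := key eD eA eB eC hin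
      cases hU : cfg.uEV with
      | none => simp [hin, hU] at hg
      | some eU =>
        simp only [hin, hU] at hg
        split_ifs at hg with hpos
        simp only [Option.some.injEq] at hg
        subst hg
        obtain ⟨t, tp, tpp, ht0, hpt, -, -, htm, -, -⟩ :=
          hop_mem_of_token tok hD hA hB hC (hA0 eA hA)
        have hUm := tok.2.1 eU hU
        unfold Entry.Mem at hUm ⊢
        simp only [Entry.encl, inflate_zero]
        rw [hpt] at hUm
        have e : p .UOverT = t * p .UOverT / t := by field_simp
        rw [e]
        exact div_mem_divPos hpos hUm htm
  | tperpOverT => simp [imageB] at hg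
  | VOverT => simp [imageB] at hg
  | WEV => simp [imageB] at hg
  | dsd => simp [imageB] at hg
  | JmeV => simp [imageB] at hg

/-- **The typed three-band → one-band statement.** The one-band box handed to S2 is the JOIN of
the direct one-band determinations (`direct`: one-band Wannier fits, one-band cRPA `U`, literature
values — each hulled per BOX-SCHEMA R1) with technique B's determination from the three-band box
`E`; INFL-3to1 is thereby «hulled in» (ROUTER v0.5 §4.3), with the declared misfits as explicit
inflation inside `imageB`. Technique A's determination (mod-3) joins the same way. [folklore] -/
def threeToOneBand (cfg : BConfig) (E : EmeryBox) (direct : OneBandBox) : OneBandBox :=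
  direct.join (imageB cfg E)

/-- **INFL-3to1 SOUNDNESS.** Under the technique-B token for `p`, and direct enclosure of `p` on
every coordinate technique B leaves undetermined, `p` lies in the delivered box. [folklore] -/
theorem threeToOneBand_mem_of_token {cfg : BConfig} {E : EmeryBox} {direct : OneBandBox}
    {p : OneBandCoord → ℝ} (hA0 : ∀ eA, E .tpd = some eA → 0 < eA.encl.fst)
    (tok : ReductionTokenB cfg E p)
    (hdir : ∀ i, imageB cfg E i = none → ∀ e, direct i = some e → e.Mem (p i)) :
    (threeToOneBand cfg E direct).Mem p := by
  have himg := imageB_mem_of_token hA0 tok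
  refine Box.mem_join fun i => ?_
  cases hI : imageB cfg E i with
  | some f => exact Or.inr (Or.inl ⟨f, rfl, himg i f hI⟩)
  | none =>
    cases hDd : direct i with
    | none => exact Or.inr (Or.inr ⟨rfl, rfl⟩)
    | some e => exact Or.inl ⟨e, rfl, hdir i hI e hDd⟩

/-- The symmetric door: a `p` enclosed by the direct determinations, and by technique B wherever
the direct box is undetermined, lies in the delivered box. [folklore] -/
theorem threeToOneBand_mem_of_direct {cfg : BConfig} {E : EmeryBox} {direct : OneBandBox}
    {p : OneBandCoord → ℝ} (hp : direct.Mem p)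
    (himg : ∀ i, direct i = none → ∀ f, imageB cfg E i = some f → f.Mem (p i)) :
    (threeToOneBand cfg E direct).Mem p := by
  refine Box.mem_join fun i => ?_
  cases hDd : direct i with
  | some e => exact Or.inl ⟨e, rfl, hp i e hDd⟩
  | none =>
    cases hI : imageB cfg E i with
    | none => exact Or.inr (Or.inr ⟨rfl, rfl⟩)
    | some f => exact Or.inr (Or.inl ⟨f, rfl, himg i hDd f hI⟩)

/-- **WORD TRANSPORT (the interface S2 consumes; reviewer R2's shape).** A word `W` certified on the
delivered box (`HoldsOn W (threeToOneBand cfg E direct)`, e.g. by `holdsOn_oneBand_of_cell` or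
`holdsOn_of_forall_s2Box`) holds at the material's effective parameters `p` under the token.
[folklore] -/
theorem threeToOneBand_word {cfg : BConfig} {E : EmeryBox} {direct : OneBandBox}
    {W : (OneBandCoord → ℝ) → Prop} (hW : HoldsOn W (threeToOneBand cfg E direct))
    {p : OneBandCoord → ℝ} (hA0 : ∀ eA, E .tpd = some eA → 0 < eA.encl.fst)
    (tok : ReductionTokenB cfg E p)
    (hdir : ∀ i, imageB cfg E i = none → ∀ e, direct i = some e → e.Mem (p i)) : W p :=
  hW p (threeToOneBand_mem_of_token hA0 tok hdir)

/-- Joining technique B's determination only widens the direct box on the direct box's support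
(inflation safety, reviewer R6): if technique B determines no coordinate the direct box leaves
undetermined, every word certified on the delivered box already holds on the direct box.
[folklore] -/
theorem holdsOn_direct_of_threeToOneBand {cfg : BConfig} {E : EmeryBox} {direct : OneBandBox}
    {W : (OneBandCoord → ℝ) → Prop} (hW : HoldsOn W (threeToOneBand cfg E direct))
    (hsupp : ∀ i, direct i = none → imageB cfg E i = none) : HoldsOn W direct :=
  hW.of_refines (Box.refines_join_left hsupp)

end Summit.Ventures.CertifiedManyBodySolver.Downfold
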